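import Mathlib
import HarnessLib
import Literature.NumberTheory.LFunctions.DoubleLargeSieve
import Literature.NumberTheory.LFunctions.BourgainTheorem4

/-!
# Bourgain's Theorem 4, steps 2–3 assembled: the double large sieve (3.8), the first spacing
# bound (3.10) and Huxley's `V`-refinement (3.14) give
# `∑_I |∑_{h ≤ H} αʰ e(x(I)·(h, h², h^{3/2}, h^{1/2}))|⁶ ≪ H^{6+ε} (V B_V)^{1/2}` — PROVED

Topic `Literature/NumberTheory/LFunctions`. Companion of `BourgainTheorem4.lean` (architecture of
the printed proof of Theorem 4 of J. Bourgain, *Decoupling, exponential sums and the Riemann zeta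
function*, J. Amer. Math. Soc. **30** (2017), §4; its step 6; the first spacing count `A` and
(3.10)), of `BourgainTheorem4Optimisation.lean` (the optimisation in `N`: (3.12) ⇒ (3.13),
(3.16) ⇒ (3.18)) and of `DoubleLargeSieve.lean` (the Bombieri–Iwaniec double large sieve,
PROVED). It proves the part of §4 that sits between the Huxley–Watt reduction (3.4)–(3.7) and the
second spacing bounds (3.11)/(3.15), i.e. everything on pp. 10–11 of the paper that does not
come from [H-W] §4 or [H1] §7:

* **(3.7) ⇒ (3.8)** "it follows by the Bombieri–Iwaniec double large sieve [B-I1], Lemma 2.4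
  (or see [H-W], Lemma 3.6) that one has
  `|∑_{I ∈ 𝓘(Q,ℓ)} ∑_{𝐡 ∈ ℕ⁶} e(x(I)·y(𝐡)) ω(I) Ω(𝐡)|² ≪ A B₁ ∏_{j ≤ 4} (X_j Y_j + 1)` (3.8),
  where `Y₁ = 6H, Y₂ = 6H², Y₃ = 6H^{3/2}, Y₄ = 6H^{1/2}`,
  `B₁ = #{(I, I') : |x_j(I) - x_j(I')| < 1/(2Y_j) (j ≤ 4)}` (3.9) and
  `A = #{(𝐡, 𝐡') ∈ ((0,H]⁶)² : |y_j(𝐡) - y_j(𝐡')| < 1/(2X_j) (j ≤ 4)}`", with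
  `y(𝐡) = ∑_{j ≤ 6} (h_j, h_j², h_j^{3/2}, h_j^{1/2})`, `X₁ = X₂ = 1/2`, `X₃ = X₄ = (R/Q)² H^{1/2}`,
  `Ω(𝐡) = α^{y₁(𝐡)}`, `|ω(I)| ≤ 1` — here for the bilinear form that (3.7) actually produces,
  `∑_I |∑_{h ≤ H} αʰ e(x(I)·(h, h², h^{3/2}, h^{1/2}))|⁶ = ∑_I ω(I) ∑_𝐡 Ω(𝐡) e(x(I)·y(𝐡))`
  (`Literature.NumberTheory.LFunctions.bourgainHSum_pow_six`, the sixth power of the inner sum of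
  (3.4) expanded over six-tuples);
* **(3.10)** `A ≪ δ² H^{10+ε}`, `δ = Q²/(H²R²)` — i.e. `X₃ = X₄ = δ⁻¹ H^{-3/2}` — from Corollary 3
  (2.28) of the paper (`Literature.NumberTheory.LFunctions.Bourgain2017_eq310_count_of_corollary3`,
  `BourgainTheorem4.lean`, Corollary 3 being an explicit hypothesis there and here), valid for
  `1/H ≤ Hδ ≤ 1`, i.e. `H^{-1/2} ≤ X₃ ≤ H^{1/2}`;
* the bound "`∏_{j ≤ 4} (X_j Y_j + 1) = (3H+1)(3H²+1)(6δ⁻¹+1)(6(Hδ)⁻¹+1) ≪ H²/δ²`" (p. 11);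
* **Huxley's `V`-refinement (3.14)**: "for an arbitrary `V ≥ 1` the structure of the
  Bombieri–Iwaniec double large sieve implies that if the factor `X₂Y₂ + 1` on the right-hand side
  of the bound (3.8) is increased to `X₂Y₂V + 1 ≤ (X₂Y₂ + 1)V` then the adjacent term `B₁` may be
  replaced by a term `B_V ≤ B₁`, the definition of which differs from that of `B₁` (in (3.9)) only
  insofar as it involves an upper bound on `|x₂(I) - x₂(I')|` that is stronger by a factor `V`"
  — which is the double large sieve applied with the box `|y₂| ≤ 6H²V ( ≥ |y₂(𝐡)|)` in place of
  `6H²`.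

## Main results (all PROVED; no named fact is introduced)

* `Literature.NumberTheory.LFunctions.bourgainMonomials`, `bourgainYVec` (`y(𝐡)`),
  `bourgainXBound` (`(X_j)`), `bourgainYBound H V` (`(Y₁, Y₂V, Y₃, Y₄)`),
  `bourgainSecondSpacingCount 𝓘 x H V` (`B_V`; `B₁` at `V = 1`, strict inequalities as printed),
  `bourgainHSum H α x` (`∑_{1 ≤ h ≤ H} αʰ e(x·(h, h², h^{3/2}, h^{1/2}))`, the inner sum of (3.4)) —
  DEFINITIONS.
* `Literature.NumberTheory.LFunctions.bourgainHSum_pow_six` — the expansion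
  `(∑_{h ≤ H} αʰ e(x·(h,h²,h^{3/2},h^{1/2})))⁶ = ∑_{𝐡 ∈ (0,H]⁶} α^{∑h_j} e(x·y(𝐡))`.
* `Literature.NumberTheory.LFunctions.Bourgain2017_eq38V` — **(3.8) with the `V`-refinement**,
  explicit constant:
  `(∑_{I∈𝓘} |bourgainHSum H α (x I)|⁶)² ≤ 624⁴ ∏_j (1 + 4 X_j Y_{V,j}) · B_V · A` for `|α| ≤ 1`,
  `|x_j(I)| ≤ X_j`, where `A = bourgainFirstSpacingCount H δ (Hδ)` (`BourgainTheorem4.lean`) with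
  `δ = 1/(X₃ H^{3/2})`.
* `Literature.NumberTheory.LFunctions.Bourgain2017_sixthMoment_of_corollary3` — **(3.8) + (3.10)
  + (3.14)**: given Corollary 3 (2.28) (explicit hypothesis), for every `ε > 0` there is `C` with
  `∑_{I ∈ 𝓘} |∑_{h ≤ H} αʰ e(x(I)·(h, h², h^{3/2}, h^{1/2}))|⁶ ≤ C H^{6+ε} (V · B_V)^{1/2}`
  for all `H ≥ 1`, `H^{-1/2} ≤ X₃ ≤ H^{1/2}`, `V ≥ 1`, all finite families `(x(I))_{I ∈ 𝓘}` with
  `|x₁(I)|, |x₂(I)| ≤ 1/2`, `|x₃(I)|, |x₄(I)| ≤ X₃`, and all `|α| ≤ 1`. With the prefactor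
  `(R log²N/Q^{1/2})⁶ (MR²/(NQ²))⁵` of (3.7) and `H ≍ NQ/R²` this is the displayed (3.14)
  `|S|⁶ ≪ (M⁵R¹⁶ log¹²N/(N⁵Q¹³)) H^{6+ε} (VB_V)^{1/2}`, and at `V = 1` the input of (3.12); the
  `T, M, N, R, Q` bookkeeping of (3.4)–(3.7), (3.11)–(3.12) and (3.15)–(3.16) is not part of this
  file.

## Proof

`∑_I |z_I| = ∑_I ω_I z_I` with `ω_I = \bar z_I/|z_I|` (`exists_unimodular_sum_norm_eq`); with
`z_I = (bourgainHSum H α (x I))⁶ = ∑_𝐡 α^{y₁(𝐡)} e(x(I)·y(𝐡))` the left side of the claim is a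
bilinear form `∑_I ∑_𝐡 ω_I Ω(𝐡) e(x(I)·y(𝐡))` with coefficients of modulus `≤ 1`, to which the
counting form of the double large sieve
(`Literature.NumberTheory.LFunctions.DoubleLargeSieve.doubleLargeSieve_count`, constant `624^K`)
is applied with the ENLARGED boxes `|x_j| ≤ X'_j = 2X_j = (1, 1, 2X₃, 2X₃)` and
`|y_j| ≤ Y'_j = 2Y_{V,j}`; the lemma as proved in this tree returns neighbour counts with NON-STRICT
inequalities `≤ 1/(2Y'_j) = 1/(4Y_{V,j})`, `≤ 1/(2X'_j)`, and these imply the STRICT printed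
conditions `< 1/(2Y_{V,j})` (so the count is `≤ B_V`, `closePairs_le_bourgainSecondSpacingCount`)
and, for the six-tuples, `|y₁ - y₁'| ≤ 1/2 < 1`, `|y₂ - y₂'| ≤ 1/2 < 1`,
`|y₃ - y₃'| ≤ 1/(4X₃) < 1/(2X₃) = H^{3/2}δ/2`, `|y₄ - y₄'| ≤ 1/(4X₃) < H^{1/2}(Hδ)/2`, which after division
by `H^{3/2}`, `H^{1/2}` are the conditions defining
`Literature.NumberTheory.LFunctions.bourgainFirstSpacingCount H δ (Hδ)` in the normalisation of
(2.28) (`closePairs_le_bourgainFirstSpacingCount`). The price is the constant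
`∏(1 + 4X_jY_{V,j}) ≤ 13²·25² · V X₃² H⁵` (for `H, V ≥ 1`, `X₃H^{1/2} ≥ 1`), against the paper's
`∏(X_jY_j + 1)V ≪ VH²/δ² = V X₃² H⁵`; with `A ≤ C δ² H^{10+2ε} = C X₃⁻² H^{7+2ε}` (3.10) the product
is `≪ V H^{12+2ε} B_V`, and a square root finishes.

## Faithfulness notes

* `B_V` (`bourgainSecondSpacingCount`) is the printed count: ordered pairs `(I, I') ∈ 𝓘²`
  (diagonal included), strict inequalities `|x_j(I) - x_j(I')| < 1/(2Y_j)` with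
  `Y = (6H, 6H²V, 6H^{3/2}, 6H^{1/2})`; at `V = 1` it is `B₁` of (3.9). The index set of the minor
  arcs is a `Finset ℕ` (the paper indexes `I = [kN, N + kN]` by `k ∈ ℕ`), the map `x` is arbitrary:
  nothing about the Huxley–Watt vectors `x(I)` is used or assumed beyond `|x_j(I)| ≤ X_j`.
* `A` is `Literature.NumberTheory.LFunctions.bourgainFirstSpacingCount H δ (Hδ)` of
  `BourgainTheorem4.lean` (strict inequalities, normalisation of (2.28)); the dictionary
  `X₃ = X₄ = (R/Q)²H^{1/2}`, `δ = Q²/(H²R²)`, hence `X₃ = δ⁻¹H^{-3/2}`, `X₃Y₃ = 6/δ`,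
  `X₄Y₄ = 6/(Hδ)`, and `1/H ≤ Hδ ≤ 1 ⟺ H^{-1/2} ≤ X₃ ≤ H^{1/2}`, is the paper's (p. 11).
* `α`: the paper has `α = e(-η)` unimodular; here any `|α| ≤ 1` (then `|Ω(𝐡)| = |α|^{y₁(𝐡)} ≤ 1`).
* Constants: the paper's `≪` hides absolute constants and `C(ε)`; here they are explicit
  (`624⁴` from `DoubleLargeSieve.lean`, `13²·25²` from the enlarged boxes) or existential (`C` of
  Corollary 3). Corollary 3 (2.28) enters as the explicit hypothesis of
  `Bourgain2017_eq310_count_of_corollary3` (its content is the paper's `ℓ²`-decoupling theorem,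
  see `BourgainDecouplingMeanValue.lean`), not as a named fact (D-0026).

## References

* J. Bourgain, *Decoupling, exponential sums and the Riemann zeta function*, J. Amer. Math. Soc.
  30 (2017), 205–224, doi:10.1090/jams/860, arXiv:1408.5794 — §4, eqs. (3.4), (3.7)–(3.10),
  (3.14). [cite: BourgainJAMS2017, §4 (3.7)–(3.10), (3.14)]
* [B-I1] E. Bombieri, H. Iwaniec, *On the order of `ζ(1/2 + it)`*, Ann. Sc. Norm. Sup. Pisa 13
  (1986), 449–472 — Lemma 2.4 (double large sieve). [cite: BombieriIwaniec1986, Lemma 2.4]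
* [H-W] M. N. Huxley, N. Watt, *Exponential sums and the Riemann zeta function*, Proc. London
  Math. Soc. (3) 57 (1988), 1–24 — Lemma 3.6.
* [H1] M. N. Huxley, *Exponential sums and the Riemann zeta function IV*, Proc. London Math. Soc.
  (3) 66 (1993), 1–40 — §7 (the factor `V`).
* S. W. Graham, G. Kolesnik, *Van der Corput's Method of Exponential Sums*, LMS Lecture Notes 126,
  CUP 1991 — Lemma 7.5. [cite: GrahamKolesnik1991, Lemma 7.5]
-/

noncomputable section

open Complex Finset MeasureTheory
open scoped Real ComplexConjugate

namespace Literature.NumberTheory.LFunctions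

open DoubleLargeSieve (closePairs doubleLargeSieve_count e_sum)
open VdC (e norm_e e_add)

/-! ## The objects of (3.4), (3.7)–(3.9) -/

/-- The monomial vector `(h, h², h^{3/2}, h^{1/2}) ∈ ℝ⁴` of (3.4).
[cite: BourgainJAMS2017, §4 eq. (3.4)] -/
def bourgainMonomials (h : ℕ) : Fin 4 → ℝ :=
  ![(h : ℝ), (h : ℝ) ^ 2, (h : ℝ) ^ (3 / 2 : ℝ), (h : ℝ) ^ (1 / 2 : ℝ)]

/-- `y(𝐡) = ∑_{j ≤ 6} (h_j, h_j², h_j^{3/2}, h_j^{1/2}) ∈ ℝ⁴` for a six-tuple `𝐡`, as in (3.7).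
[cite: BourgainJAMS2017, §4 eq. (3.7)] -/
def bourgainYVec (w : Fin 6 → ℕ) : Fin 4 → ℝ := fun k => ∑ j, bourgainMonomials (w j) k

/-- The box sizes `(X₁, X₂, X₃, X₄) = (1/2, 1/2, X₃, X₃)` of (3.4) (in the paper
`X₃ = X₄ = (R/Q)² H^{1/2}`). [cite: BourgainJAMS2017, §4, display after (3.4)] -/
def bourgainXBound (X₃ : ℝ) : Fin 4 → ℝ := ![1 / 2, 1 / 2, X₃, X₃]

/-- The box sizes `(Y₁, Y₂V, Y₃, Y₄) = (6H, 6H²V, 6H^{3/2}, 6H^{1/2})` of (3.9), with Huxley's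
factor `V ≥ 1` on the second coordinate ((3.14); `V = 1` is (3.9)).
[cite: BourgainJAMS2017, §4 eq. (3.9) and the paragraph before (3.14)] -/
def bourgainYBound (H : ℕ) (V : ℝ) : Fin 4 → ℝ :=
  ![6 * (H : ℝ), 6 * (H : ℝ) ^ 2 * V, 6 * (H : ℝ) ^ (3 / 2 : ℝ), 6 * (H : ℝ) ^ (1 / 2 : ℝ)]

/-- The second spacing count `B_V` of the family `(x(I))_{I ∈ 𝓘}`: the number of ordered pairs
`(I, I') ∈ 𝓘²` with `|x_j(I) - x_j(I')| < 1/(2Y_j)` for `j ≠ 2` and `|x₂(I) - x₂(I')| < 1/(2Y₂V)`;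
`B₁` (`V = 1`) is the count of (3.9). [cite: BourgainJAMS2017, §4 eq. (3.9) and before (3.14)] -/
def bourgainSecondSpacingCount (𝓘 : Finset ℕ) (x : ℕ → Fin 4 → ℝ) (H : ℕ) (V : ℝ) : ℕ :=
  ((𝓘 ×ˢ 𝓘).filter fun p => ∀ k, |x p.1 k - x p.2 k| < (2 * bourgainYBound H V k)⁻¹).card

/-- The inner sum of (3.4): `∑_{1 ≤ h ≤ H} αʰ e(x · (h, h², h^{3/2}, h^{1/2}))`, `e(t) = exp(2πit)`.
[cite: BourgainJAMS2017, §4 eq. (3.4)] -/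
def bourgainHSum (H : ℕ) (α : ℂ) (x : Fin 4 → ℝ) : ℂ :=
  ∑ h ∈ Finset.Icc 1 H, α ^ h * e (∑ k, x k * bourgainMonomials h k)

/-! ## Elementary properties -/

/-- The monomials are non-negative. [folklore] -/
theorem bourgainMonomials_nonneg (h : ℕ) (k : Fin 4) : 0 ≤ bourgainMonomials h k := by
  fin_cases k
  · show (0 : ℝ) ≤ h; positivity
  · show (0 : ℝ) ≤ (h : ℝ) ^ 2; positivity
  · show (0 : ℝ) ≤ (h : ℝ) ^ (3 / 2 : ℝ); positivity
  · show (0 : ℝ) ≤ (h : ℝ) ^ (1 / 2 : ℝ); positivity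

/-- The monomials are monotone in `h`. [folklore] -/
theorem bourgainMonomials_mono {h H : ℕ} (hh : h ≤ H) (k : Fin 4) :
    bourgainMonomials h k ≤ bourgainMonomials H k := by
  have hR : (h : ℝ) ≤ H := by exact_mod_cast hh
  have h0 : (0 : ℝ) ≤ h := Nat.cast_nonneg _
  fin_cases k
  · show (h : ℝ) ≤ H; exact hR
  · show (h : ℝ) ^ 2 ≤ (H : ℝ) ^ 2; exact pow_le_pow_left₀ h0 hR 2
  · show (h : ℝ) ^ (3 / 2 : ℝ) ≤ (H : ℝ) ^ (3 / 2 : ℝ); exact Real.rpow_le_rpow h0 hR (by norm_num)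
  · show (h : ℝ) ^ (1 / 2 : ℝ) ≤ (H : ℝ) ^ (1 / 2 : ℝ); exact Real.rpow_le_rpow h0 hR (by norm_num)

/-- `Y_j = 6 · (H, H², H^{3/2}, H^{1/2})_j` at `V = 1`. [folklore] -/
theorem bourgainYBound_one (H : ℕ) (k : Fin 4) :
    bourgainYBound H 1 k = 6 * bourgainMonomials H k := by
  fin_cases k
  · rfl
  · show 6 * (H : ℝ) ^ 2 * 1 = 6 * (H : ℝ) ^ 2; ring
  · rfl
  · rfl

/-- `Y_{1,j} ≤ Y_{V,j}` for `V ≥ 1`. [folklore] -/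
theorem bourgainYBound_one_le {H : ℕ} {V : ℝ} (hV : 1 ≤ V) (k : Fin 4) :
    bourgainYBound H 1 k ≤ bourgainYBound H V k := by
  fin_cases k
  · exact le_rfl
  · show 6 * (H : ℝ) ^ 2 * 1 ≤ 6 * (H : ℝ) ^ 2 * V
    exact mul_le_mul_of_nonneg_left hV (by positivity)
  · exact le_rfl
  · exact le_rfl

/-- `Y_{V,j} > 0` for `H ≥ 1`, `V > 0`. [folklore] -/
theorem bourgainYBound_pos {H : ℕ} (hH : 1 ≤ H) {V : ℝ} (hV : 0 < V) (k : Fin 4) :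
    0 < bourgainYBound H V k := by
  have hHpos : (0 : ℝ) < H := by exact_mod_cast hH
  fin_cases k
  · show (0 : ℝ) < 6 * (H : ℝ); positivity
  · show (0 : ℝ) < 6 * (H : ℝ) ^ 2 * V; positivity
  · show (0 : ℝ) < 6 * (H : ℝ) ^ (3 / 2 : ℝ); positivity
  · show (0 : ℝ) < 6 * (H : ℝ) ^ (1 / 2 : ℝ); positivity

/-- `X_j > 0` for `X₃ > 0`. [folklore] -/
theorem bourgainXBound_pos {X₃ : ℝ} (hX₃ : 0 < X₃) (k : Fin 4) : 0 < bourgainXBound X₃ k := by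
  fin_cases k
  · show (0 : ℝ) < 1 / 2; norm_num
  · show (0 : ℝ) < 1 / 2; norm_num
  · show (0 : ℝ) < X₃; exact hX₃
  · show (0 : ℝ) < X₃; exact hX₃

/-- `|y_j(𝐡)| ≤ Y_j` for `𝐡 ∈ (0, H]⁶` (the ranges `Y_j` of (3.9)). [cite: BourgainJAMS2017, §4 (3.9)] -/
theorem abs_bourgainYVec_le {H : ℕ} {w : Fin 6 → ℕ}
    (hw : w ∈ Fintype.piFinset fun _ : Fin 6 => Finset.Icc 1 H) (k : Fin 4) :
    |bourgainYVec w k| ≤ bourgainYBound H 1 k := by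
  rw [bourgainYBound_one, bourgainYVec,
    abs_of_nonneg (Finset.sum_nonneg fun j _ => bourgainMonomials_nonneg _ _)]
  calc ∑ j, bourgainMonomials (w j) k ≤ ∑ _j : Fin 6, bourgainMonomials H k :=
        Finset.sum_le_sum fun j _ => bourgainMonomials_mono
          (Finset.mem_Icc.1 (Fintype.mem_piFinset.1 hw j)).2 k
    _ = 6 * bourgainMonomials H k := by simp

/-! ## The sixth power of the inner sum ((3.4) ⇒ the bilinear form of (3.7)) -/

/-- **Expansion of the sixth power over six-tuples**:
`(∑_{1 ≤ h ≤ H} αʰ e(x·(h, h², h^{3/2}, h^{1/2})))⁶ = ∑_{𝐡 ∈ (0,H]⁶} α^{h₁+⋯+h₆} e(x · y(𝐡))`, the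
bilinear structure `e(x(I)·y(𝐡)) Ω(𝐡)`, `Ω(𝐡) = α^{y₁(𝐡)}`, of (3.7).
[cite: BourgainJAMS2017, §4 eq. (3.7)] -/
theorem bourgainHSum_pow_six (H : ℕ) (α : ℂ) (x : Fin 4 → ℝ) :
    bourgainHSum H α x ^ 6 =
      ∑ w ∈ Fintype.piFinset (fun _ : Fin 6 => Finset.Icc 1 H),
        α ^ (∑ j, w j) * e (∑ k, x k * bourgainYVec w k) := by
  unfold bourgainHSum
  have h6 : (∑ h ∈ Finset.Icc 1 H, α ^ h * e (∑ k, x k * bourgainMonomials h k)) ^ 6 =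
      ∏ _j : Fin 6, ∑ h ∈ Finset.Icc 1 H, α ^ h * e (∑ k, x k * bourgainMonomials h k) := by
    rw [Finset.prod_const, Finset.card_univ, Fintype.card_fin]
  rw [h6, Finset.prod_univ_sum (fun _ : Fin 6 => Finset.Icc 1 H)
    (fun _ h => α ^ h * e (∑ k, x k * bourgainMonomials h k))]
  refine Finset.sum_congr rfl fun w _ => ?_
  rw [Finset.prod_mul_distrib, Finset.prod_pow_eq_pow_sum, ← e_sum]
  have hsum : ∑ j, ∑ k, x k * bourgainMonomials (w j) k = ∑ k, x k * bourgainYVec w k := by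
    rw [Finset.sum_comm]
    simp only [bourgainYVec, Finset.mul_sum]
  rw [hsum]

/-- `∑_i |z_i| = ∑_i ω_i z_i` with `|ω_i| ≤ 1` (`ω_i = \bar z_i / |z_i|`): the weights `ω(I)` of
(3.7). [folklore] -/
theorem exists_unimodular_sum_norm_eq {ι : Type*} (s : Finset ι) (z : ι → ℂ) :
    ∃ ω : ι → ℂ, (∀ i, ‖ω i‖ ≤ 1) ∧
      (((∑ i ∈ s, ‖z i‖ : ℝ)) : ℂ) = ∑ i ∈ s, ω i * z i := by
  refine ⟨fun i => conj (z i) * ((‖z i‖ : ℂ))⁻¹, fun i => ?_, ?_⟩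
  · rw [norm_mul, norm_inv, Complex.norm_conj, Complex.norm_real, Real.norm_eq_abs, abs_norm,
      ← div_eq_mul_inv]
    exact div_self_le_one _
  · rw [Complex.ofReal_sum]
    refine Finset.sum_congr rfl fun i _ => ?_
    by_cases hz : z i = 0
    · simp [hz]
    · have hne : ((‖z i‖ : ℝ) : ℂ) ≠ 0 := by exact_mod_cast norm_ne_zero_iff.2 hz
      rw [mul_right_comm, Complex.conj_mul', sq, mul_assoc, mul_inv_cancel₀ hne, mul_one]

/-! ## Comparison of the neighbour counts of the double large sieve with `A` and `B_V` -/

/-- The non-strict neighbour count of `DoubleLargeSieve.lean` is dominated by the count of any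
weaker condition (the decidability instance is taken from the target, not synthesized).
[folklore] -/
theorem closePairs_le_card_filter {ι β : Type*} [Fintype ι] (s : Finset β) (y : β → ι → ℝ)
    (δ : ι → ℝ) (P : β × β → Prop) {hP : DecidablePred P}
    (h : ∀ p ∈ s ×ˢ s, (∀ k, |y p.1 k - y p.2 k| ≤ δ k) → P p) :
    closePairs s y δ ≤ ((s ×ˢ s).filter P).card := by
  unfold DoubleLargeSieve.closePairs
  refine Finset.card_le_card fun p hp => ?_
  have hp' := Finset.mem_filter.1 hp
  exact (@Finset.mem_filter _ P hP (s ×ˢ s) p).2 ⟨hp'.1, h p hp'.1 hp'.2⟩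

/-- The non-strict count at thresholds `1/(4Y_{V,j})` is at most the strict count `B_V`
(thresholds `1/(2Y_{V,j})`). [folklore] -/
theorem closePairs_le_bourgainSecondSpacingCount (𝓘 : Finset ℕ) (x : ℕ → Fin 4 → ℝ) {H : ℕ}
    {V : ℝ} (hY : ∀ k, 0 < bourgainYBound H V k) :
    closePairs 𝓘 x (fun k => (2 * (2 * bourgainYBound H V k))⁻¹) ≤
      bourgainSecondSpacingCount 𝓘 x H V := by
  unfold bourgainSecondSpacingCount
  refine closePairs_le_card_filter 𝓘 x _ _ fun p _ hp k => (hp k).trans_lt ?_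
  rw [inv_lt_inv₀ (mul_pos two_pos (mul_pos two_pos (hY k))) (mul_pos two_pos (hY k))]
  linarith [hY k]

/-- The non-strict count for the six-tuples at thresholds `1/(2X'_j)`, `X' = (1, 1, 2X₃, 2X₃)`,
is at most the strict first spacing count `A = bourgainFirstSpacingCount H δ (Hδ)` of
`BourgainTheorem4.lean` (normalisation of (2.28)) with `δ = 1/(X₃ H^{3/2})`:
`|Δy₁|, |Δy₂| ≤ 1/2 < 1`, `|Δy₃| ≤ 1/(4X₃) < H^{3/2} δ/2`, `|Δy₄| ≤ 1/(4X₃) < H^{1/2} (Hδ)/2`.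
[cite: BourgainJAMS2017, §4, definition of `A` after (3.9) and p. 11] -/
theorem closePairs_le_bourgainFirstSpacingCount {H : ℕ} (hH : 1 ≤ H) {X₃ : ℝ} (hX₃ : 0 < X₃) :
    closePairs (Fintype.piFinset fun _ : Fin 6 => Finset.Icc 1 H) bourgainYVec
        (fun k => (2 * (2 * bourgainXBound X₃ k))⁻¹) ≤
      bourgainFirstSpacingCount H (1 / (X₃ * (H : ℝ) ^ (3 / 2 : ℝ)))
        (H * (1 / (X₃ * (H : ℝ) ^ (3 / 2 : ℝ)))) := by
  classical
  have hHpos : (0 : ℝ) < H := by exact_mod_cast hH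
  have h32 : (0 : ℝ) < (H : ℝ) ^ (3 / 2 : ℝ) := by positivity
  have h12 : (0 : ℝ) < (H : ℝ) ^ (1 / 2 : ℝ) := by positivity
  have hH32 : (H : ℝ) ^ (3 / 2 : ℝ) = H * (H : ℝ) ^ (1 / 2 : ℝ) := by
    rw [show (3 / 2 : ℝ) = 1 + 1 / 2 by norm_num, Real.rpow_add hHpos, Real.rpow_one]
  -- the coordinates of `y(w)`
  have y0 : ∀ w : Fin 6 → ℕ, bourgainYVec w 0 = ∑ j, (w j : ℝ) := fun w => rfl
  have y1 : ∀ w : Fin 6 → ℕ, bourgainYVec w 1 = ∑ j, (w j : ℝ) ^ 2 := fun w => rfl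
  have y2 : ∀ w : Fin 6 → ℕ, bourgainYVec w 2 = ∑ j, (w j : ℝ) ^ (3 / 2 : ℝ) := fun w => rfl
  have y3 : ∀ w : Fin 6 → ℕ, bourgainYVec w 3 = ∑ j, (w j : ℝ) ^ (1 / 2 : ℝ) := fun w => rfl
  -- normalised sums
  have n2 : ∀ w : Fin 6 → ℕ, ∑ j, ((w j : ℝ) / H) ^ (3 / 2 : ℝ) =
      (∑ j, (w j : ℝ) ^ (3 / 2 : ℝ)) / (H : ℝ) ^ (3 / 2 : ℝ) := fun w => by
    rw [Finset.sum_div]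
    exact Finset.sum_congr rfl fun j _ => Real.div_rpow (Nat.cast_nonneg _) hHpos.le _
  have n3 : ∀ w : Fin 6 → ℕ, ∑ j, ((w j : ℝ) / H) ^ (1 / 2 : ℝ) =
      (∑ j, (w j : ℝ) ^ (1 / 2 : ℝ)) / (H : ℝ) ^ (1 / 2 : ℝ) := fun w => by
    rw [Finset.sum_div]
    exact Finset.sum_congr rfl fun j _ => Real.div_rpow (Nat.cast_nonneg _) hHpos.le _
  -- the thresholds
  have t0 : (2 * (2 * bourgainXBound X₃ 0))⁻¹ = 1 / 2 := by
    show (2 * (2 * (1 / 2 : ℝ)))⁻¹ = 1 / 2; norm_num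
  have t1 : (2 * (2 * bourgainXBound X₃ 1))⁻¹ = 1 / 2 := by
    show (2 * (2 * (1 / 2 : ℝ)))⁻¹ = 1 / 2; norm_num
  have t2 : (2 * (2 * bourgainXBound X₃ 2))⁻¹ = (1 / 4) * X₃⁻¹ := by
    show (2 * (2 * X₃))⁻¹ = (1 / 4) * X₃⁻¹; rw [mul_inv, mul_inv]; ring
  have t3 : (2 * (2 * bourgainXBound X₃ 3))⁻¹ = (1 / 4) * X₃⁻¹ := by
    show (2 * (2 * X₃))⁻¹ = (1 / 4) * X₃⁻¹; rw [mul_inv, mul_inv]; ring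
  unfold bourgainFirstSpacingCount
  refine closePairs_le_card_filter _ bourgainYVec _ _ fun p _ hp => ⟨?_, ?_, ?_, ?_⟩
  · have h := hp 0
    rw [t0, y0, y0] at h
    linarith
  · have h := hp 1
    rw [t1, y1, y1] at h
    linarith
  · have h := hp 2
    rw [t2, y2, y2] at h
    rw [n2, n2, ← sub_div, abs_div, abs_of_pos h32, div_lt_iff₀ h32]
    have hX : |∑ j, (p.1 j : ℝ) ^ (3 / 2 : ℝ) - ∑ j, (p.2 j : ℝ) ^ (3 / 2 : ℝ)| * X₃ ≤ 1 / 4 := by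
      calc _ ≤ (1 / 4) * X₃⁻¹ * X₃ := mul_le_mul_of_nonneg_right h hX₃.le
        _ = 1 / 4 := by field_simp
    have e1 : 1 / (X₃ * (H : ℝ) ^ (3 / 2 : ℝ)) / 2 * (H : ℝ) ^ (3 / 2 : ℝ) = (1 / 2) * X₃⁻¹ := by
      field_simp
    rw [e1]
    have : |∑ j, (p.1 j : ℝ) ^ (3 / 2 : ℝ) - ∑ j, (p.2 j : ℝ) ^ (3 / 2 : ℝ)| =
        (|∑ j, (p.1 j : ℝ) ^ (3 / 2 : ℝ) - ∑ j, (p.2 j : ℝ) ^ (3 / 2 : ℝ)| * X₃) * X₃⁻¹ := by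
      field_simp
    rw [this]
    have hXi : 0 < X₃⁻¹ := inv_pos.2 hX₃
    nlinarith
  · have h := hp 3
    rw [t3, y3, y3] at h
    rw [n3, n3, ← sub_div, abs_div, abs_of_pos h12, div_lt_iff₀ h12]
    have hX : |∑ j, (p.1 j : ℝ) ^ (1 / 2 : ℝ) - ∑ j, (p.2 j : ℝ) ^ (1 / 2 : ℝ)| * X₃ ≤ 1 / 4 := by
      calc _ ≤ (1 / 4) * X₃⁻¹ * X₃ := mul_le_mul_of_nonneg_right h hX₃.le
        _ = 1 / 4 := by field_simp
    have e1 : (H : ℝ) * (1 / (X₃ * (H : ℝ) ^ (3 / 2 : ℝ))) / 2 * (H : ℝ) ^ (1 / 2 : ℝ) =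
        (1 / 2) * X₃⁻¹ := by
      rw [hH32]; field_simp
    rw [e1]
    have : |∑ j, (p.1 j : ℝ) ^ (1 / 2 : ℝ) - ∑ j, (p.2 j : ℝ) ^ (1 / 2 : ℝ)| =
        (|∑ j, (p.1 j : ℝ) ^ (1 / 2 : ℝ) - ∑ j, (p.2 j : ℝ) ^ (1 / 2 : ℝ)| * X₃) * X₃⁻¹ := by
      field_simp
    rw [this]
    have hXi : 0 < X₃⁻¹ := inv_pos.2 hX₃
    nlinarith

/-! ## (3.8) with Huxley's factor `V` -/

/-- **Bourgain 2017, (3.8) (with the `V`-refinement of (3.14)), explicit constant**: for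
`H ≥ 1`, `X₃ > 0`, `V ≥ 1`, a finite family `(x(I))_{I ∈ 𝓘}` with `|x_j(I)| ≤ X_j`,
`X = (1/2, 1/2, X₃, X₃)`, and `|α| ≤ 1`,
`(∑_{I ∈ 𝓘} |∑_{h ≤ H} αʰ e(x(I)·(h,h²,h^{3/2},h^{1/2}))|⁶)² ≤ 624⁴ ∏_j (1 + 4X_jY_{V,j}) · B_V · A`,
where `A = bourgainFirstSpacingCount H δ (Hδ)`, `δ = 1/(X₃H^{3/2})` (in the paper
`δ = Q²/(H²R²)`, `X₃ = (R/Q)²H^{1/2}`) and `B_V = bourgainSecondSpacingCount 𝓘 x H V`. The left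
side is `|∑_I ∑_𝐡 ω(I) Ω(𝐡) e(x(I)·y(𝐡))|²` for the bilinear form of (3.7); the bound is the
double large sieve [B-I1] Lemma 2.4 in the counting form
`Literature.NumberTheory.LFunctions.DoubleLargeSieve.doubleLargeSieve_count`, applied with the
boxes `2X_j`, `2Y_{V,j}`. [cite: BourgainJAMS2017, §4 eqs. (3.7)–(3.9), (3.14)]
[cite: BombieriIwaniec1986, Lemma 2.4] -/
theorem Bourgain2017_eq38V {H : ℕ} (hH : 1 ≤ H) {X₃ : ℝ} (hX₃ : 0 < X₃) {V : ℝ} (hV : 1 ≤ V)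
    (𝓘 : Finset ℕ) (x : ℕ → Fin 4 → ℝ) (hx : ∀ I ∈ 𝓘, ∀ k, |x I k| ≤ bourgainXBound X₃ k)
    (α : ℂ) (hα : ‖α‖ ≤ 1) :
    (∑ I ∈ 𝓘, ‖bourgainHSum H α (x I)‖ ^ 6) ^ 2 ≤
      624 ^ 4 * (∏ k, (1 + 2 * bourgainXBound X₃ k * (2 * bourgainYBound H V k))) *
        (bourgainSecondSpacingCount 𝓘 x H V : ℝ) *
        (bourgainFirstSpacingCount H (1 / (X₃ * (H : ℝ) ^ (3 / 2 : ℝ)))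
          (H * (1 / (X₃ * (H : ℝ) ^ (3 / 2 : ℝ)))) : ℝ) := by
  classical
  set sY := Fintype.piFinset fun _ : Fin 6 => Finset.Icc 1 H with hsY
  set b : (Fin 6 → ℕ) → ℂ := fun w => α ^ (∑ j, w j) with hb
  set X' : Fin 4 → ℝ := fun k => 2 * bourgainXBound X₃ k with hX'
  set Y' : Fin 4 → ℝ := fun k => 2 * bourgainYBound H V k with hY'
  have hV0 : 0 < V := by linarith
  obtain ⟨ω, hω, hsum⟩ := exists_unimodular_sum_norm_eq 𝓘 (fun I => bourgainHSum H α (x I) ^ 6)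
  -- the sum of sixth powers as the bilinear form of (3.7)
  have hbil : (((∑ I ∈ 𝓘, ‖bourgainHSum H α (x I)‖ ^ 6 : ℝ)) : ℂ) =
      ∑ I ∈ 𝓘, ∑ w ∈ sY, ω I * b w * e (∑ k, x I k * bourgainYVec w k) := by
    have h1 : (∑ I ∈ 𝓘, ‖bourgainHSum H α (x I)‖ ^ 6) =
        ∑ I ∈ 𝓘, ‖bourgainHSum H α (x I) ^ 6‖ := by
      simp_rw [norm_pow]
    rw [h1, hsum]
    refine Finset.sum_congr rfl fun I _ => ?_
    rw [bourgainHSum_pow_six, Finset.mul_sum]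
    refine Finset.sum_congr rfl fun w _ => ?_
    simp only [hb]
    ring
  have hXpos : ∀ k, 0 < X' k := fun k => mul_pos two_pos (bourgainXBound_pos hX₃ k)
  have hYpos : ∀ k, 0 < Y' k := fun k => mul_pos two_pos (bourgainYBound_pos hH hV0 k)
  have hx' : ∀ I ∈ 𝓘, ∀ k, |x I k| ≤ X' k := fun I hI k =>
    (hx I hI k).trans (by simp only [hX']; linarith [bourgainXBound_pos hX₃ k])
  have hy' : ∀ w ∈ sY, ∀ k, |bourgainYVec w k| ≤ Y' k := fun w hw k =>
    ((abs_bourgainYVec_le hw k).trans (bourgainYBound_one_le hV k)).trans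
      (by simp only [hY']; linarith [bourgainYBound_pos hH hV0 k])
  have hbn : ∀ w ∈ sY, ‖b w‖ ≤ 1 := fun w _ => by
    simp only [hb, norm_pow]
    exact pow_le_one₀ (norm_nonneg _) hα
  have hDLS := doubleLargeSieve_count 𝓘 sY x bourgainYVec ω b X' Y' hXpos hYpos hx' hy'
    (fun I _ => hω I) hbn
  have hL : ‖∑ I ∈ 𝓘, ∑ w ∈ sY, ω I * b w * e (∑ k, x I k * bourgainYVec w k)‖ ^ 2 =
      (∑ I ∈ 𝓘, ‖bourgainHSum H α (x I)‖ ^ 6) ^ 2 := by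
    rw [← hbil, Complex.norm_real, Real.norm_eq_abs,
      abs_of_nonneg (Finset.sum_nonneg fun _ _ => by positivity)]
  rw [hL, Fintype.card_fin] at hDLS
  refine hDLS.trans ?_
  have hB : (closePairs 𝓘 x (fun k => (2 * Y' k)⁻¹) : ℝ) ≤ bourgainSecondSpacingCount 𝓘 x H V := by
    exact_mod_cast closePairs_le_bourgainSecondSpacingCount 𝓘 x (bourgainYBound_pos hH hV0)
  have hA : (closePairs sY bourgainYVec (fun k => (2 * X' k)⁻¹) : ℝ) ≤
      bourgainFirstSpacingCount H (1 / (X₃ * (H : ℝ) ^ (3 / 2 : ℝ)))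
        (H * (1 / (X₃ * (H : ℝ) ^ (3 / 2 : ℝ)))) := by
    exact_mod_cast closePairs_le_bourgainFirstSpacingCount hH hX₃
  have h0 : (0 : ℝ) ≤ 624 ^ 4 * ∏ k, (1 + X' k * Y' k) :=
    mul_nonneg (by positivity) (Finset.prod_nonneg fun k _ => by nlinarith [hXpos k, hYpos k])
  have hprod : ∏ k, (1 + X' k * Y' k) =
      ∏ k, (1 + 2 * bourgainXBound X₃ k * (2 * bourgainYBound H V k)) :=
    Finset.prod_congr rfl fun k _ => by simp only [hX', hY']
  calc (624 : ℝ) ^ 4 * (∏ k, (1 + X' k * Y' k)) *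
        (closePairs 𝓘 x (fun k => (2 * Y' k)⁻¹) : ℝ) *
        (closePairs sY bourgainYVec (fun k => (2 * X' k)⁻¹) : ℝ)
      ≤ 624 ^ 4 * (∏ k, (1 + X' k * Y' k)) * (bourgainSecondSpacingCount 𝓘 x H V : ℝ) *
        (closePairs sY bourgainYVec (fun k => (2 * X' k)⁻¹) : ℝ) :=
        mul_le_mul_of_nonneg_right (mul_le_mul_of_nonneg_left hB h0) (Nat.cast_nonneg _)
    _ ≤ 624 ^ 4 * (∏ k, (1 + X' k * Y' k)) * (bourgainSecondSpacingCount 𝓘 x H V : ℝ) *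
        (bourgainFirstSpacingCount H (1 / (X₃ * (H : ℝ) ^ (3 / 2 : ℝ)))
          (H * (1 / (X₃ * (H : ℝ) ^ (3 / 2 : ℝ)))) : ℝ) :=
        mul_le_mul_of_nonneg_left hA (mul_nonneg h0 (Nat.cast_nonneg _))
    _ = _ := by rw [hprod]

/-- The product of the box factors with the enlarged boxes:
`∏_j (1 + 4X_jY_{V,j}) = (1 + 12H)(1 + 12H²V)(1 + 24X₃H^{3/2})(1 + 24X₃H^{1/2}) ≤ 13²·25² V X₃² H⁵`
for `H, V ≥ 1` and `X₃H^{1/2} ≥ 1` (the paper: `∏(X_jY_j + 1) ≪ H²/δ² = X₃²H⁵`, p. 11).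
[cite: BourgainJAMS2017, §4, display before (3.14)] -/
theorem prod_bourgainBoxFactors_le {H : ℕ} (hH : 1 ≤ H) {X₃ : ℝ} (hX₃ : 0 < X₃)
    (hXH : 1 ≤ X₃ * (H : ℝ) ^ (1 / 2 : ℝ)) {V : ℝ} (hV : 1 ≤ V) :
    ∏ k, (1 + 2 * bourgainXBound X₃ k * (2 * bourgainYBound H V k)) ≤
      105625 * V * X₃ ^ 2 * (H : ℝ) ^ (5 : ℝ) := by
  have hHpos : (0 : ℝ) < H := by exact_mod_cast hH
  have hH1 : (1 : ℝ) ≤ H := by exact_mod_cast hH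
  set s : ℝ := (H : ℝ) ^ (1 / 2 : ℝ) with hs
  have hspos : 0 < s := by positivity
  have hs2 : s ^ 2 = H := by
    rw [hs, ← Real.rpow_natCast, ← Real.rpow_mul hHpos.le]; norm_num
  have hH32 : (H : ℝ) ^ (3 / 2 : ℝ) = H * s := by
    rw [hs, show (3 / 2 : ℝ) = 1 + 1 / 2 by norm_num, Real.rpow_add hHpos, Real.rpow_one]
  have hH5 : (H : ℝ) ^ (5 : ℝ) = (H : ℝ) ^ 4 * s ^ 2 := by
    rw [hs2, show (5 : ℝ) = ((5 : ℕ) : ℝ) by norm_num, Real.rpow_natCast]; ring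
  rw [Fin.prod_univ_four]
  have hform : (1 + 2 * bourgainXBound X₃ 0 * (2 * bourgainYBound H V 0)) *
      (1 + 2 * bourgainXBound X₃ 1 * (2 * bourgainYBound H V 1)) *
      (1 + 2 * bourgainXBound X₃ 2 * (2 * bourgainYBound H V 2)) *
      (1 + 2 * bourgainXBound X₃ 3 * (2 * bourgainYBound H V 3)) =
      (1 + 12 * (H : ℝ)) * (1 + 12 * ((H : ℝ) ^ 2 * V)) * (1 + 24 * (X₃ * (H * s))) *
        (1 + 24 * (X₃ * s)) := by
    show (1 + 2 * (1 / 2 : ℝ) * (2 * (6 * (H : ℝ)))) * (1 + 2 * (1 / 2 : ℝ) * (2 * (6 * (H : ℝ) ^ 2 * V))) *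
      (1 + 2 * X₃ * (2 * (6 * (H : ℝ) ^ (3 / 2 : ℝ)))) *
      (1 + 2 * X₃ * (2 * (6 * (H : ℝ) ^ (1 / 2 : ℝ)))) = _
    rw [hH32]; ring
  rw [hform, hH5]
  have hV0 : 0 < V := by linarith
  have hH2V : 1 ≤ (H : ℝ) ^ 2 * V := by nlinarith
  have hXHs : 1 ≤ X₃ * (H * s) := by
    calc (1 : ℝ) ≤ X₃ * s := hXH
      _ ≤ X₃ * s * H := le_mul_of_one_le_right (by positivity) hH1
      _ = X₃ * (H * s) := by ring
  have f1 : 1 + 12 * (H : ℝ) ≤ 13 * H := by linarith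
  have f2 : 1 + 12 * ((H : ℝ) ^ 2 * V) ≤ 13 * ((H : ℝ) ^ 2 * V) := by linarith
  have f3 : 1 + 24 * (X₃ * (H * s)) ≤ 25 * (X₃ * (H * s)) := by linarith
  have f4 : 1 + 24 * (X₃ * s) ≤ 25 * (X₃ * s) := by linarith
  calc (1 + 12 * (H : ℝ)) * (1 + 12 * ((H : ℝ) ^ 2 * V)) * (1 + 24 * (X₃ * (H * s))) *
        (1 + 24 * (X₃ * s))
      ≤ (13 * H) * (13 * ((H : ℝ) ^ 2 * V)) * (25 * (X₃ * (H * s))) * (25 * (X₃ * s)) := by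
        gcongr
    _ = 105625 * V * X₃ ^ 2 * ((H : ℝ) ^ 4 * s ^ 2) := by ring

/-- **Bourgain 2017, §4: (3.8) + (3.10) + the `V`-refinement (3.14), assembled.** Assume
Corollary 3 (2.28) of the paper (hypothesis `hC3`, written out explicitly as in
`BourgainDecouplingMeanValue.lean`: `A₆(N, δ, Δ) ≤ C(ε) δΔN^{9+ε}` for `N ≥ 1`, `1/N² ≤ δ ≤ 1`,
`1/N ≤ Δ ≤ 1`). Then for every `ε > 0` there is `C` such that for all `H ≥ 1`, all
`H^{-1/2} ≤ X₃ ≤ H^{1/2}` (i.e. `1/H ≤ Hδ ≤ 1` for `δ = 1/(X₃H^{3/2}) = Q²/(H²R²)`), all `V ≥ 1`,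
every finite family `(x(I))_{I ∈ 𝓘}` with `|x₁(I)|, |x₂(I)| ≤ 1/2`, `|x₃(I)|, |x₄(I)| ≤ X₃`, and every
`|α| ≤ 1`,
`∑_{I ∈ 𝓘} |∑_{h ≤ H} αʰ e(x(I)·(h, h², h^{3/2}, h^{1/2}))|⁶ ≤ C H^{6+ε} (V B_V)^{1/2}`,
`B_V = bourgainSecondSpacingCount 𝓘 x H V`. Multiplied by the prefactor
`(R log²N/Q^{1/2})⁶ (MR²/(NQ²))⁵` of (3.7) this is the displayed bound (3.14)
"`|S|⁶ ≪ (M⁵R¹⁶log¹²N/(N⁵Q¹³)) H^{6+ε} (VB_V)^{1/2}`" (with `H ≍ NQ/R²`,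
`≪ (M⁵R⁴N^{1+ε}/Q⁷)(VB_V)^{1/2}`), and at `V = 1` the combination of (3.7), (3.8), (3.10) entering
(3.12). [cite: BourgainJAMS2017, §4 eqs. (3.8), (3.10), (3.14)] -/
theorem Bourgain2017_sixthMoment_of_corollary3
    (hC3 : ∀ ε : ℝ, 0 < ε → ∃ C : ℝ, ∀ N : ℕ, 1 ≤ N → ∀ δ Δ : ℝ,
      1 / (N : ℝ) ^ 2 ≤ δ → δ ≤ 1 → 1 / (N : ℝ) ≤ Δ → Δ ≤ 1 →
        bourgainA6 N δ Δ ≤ C * δ * Δ * (N : ℝ) ^ (9 + ε))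
    {ε : ℝ} (hε : 0 < ε) :
    ∃ C : ℝ, ∀ H : ℕ, 1 ≤ H → ∀ X₃ : ℝ, (H : ℝ) ^ (-(1 / 2 : ℝ)) ≤ X₃ →
      X₃ ≤ (H : ℝ) ^ (1 / 2 : ℝ) → ∀ V : ℝ, 1 ≤ V → ∀ (𝓘 : Finset ℕ) (x : ℕ → Fin 4 → ℝ),
        (∀ I ∈ 𝓘, ∀ k, |x I k| ≤ bourgainXBound X₃ k) → ∀ α : ℂ, ‖α‖ ≤ 1 →
          ∑ I ∈ 𝓘, ‖bourgainHSum H α (x I)‖ ^ 6 ≤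
            C * (H : ℝ) ^ (6 + ε) * Real.sqrt (V * bourgainSecondSpacingCount 𝓘 x H V) := by
  obtain ⟨CA, hCA⟩ := Bourgain2017_eq310_count_of_corollary3 hC3 (show 0 < 2 * ε by linarith)
  set C₀ : ℝ := 624 ^ 4 * 105625 * max CA 0 with hC₀
  have hC₀0 : 0 ≤ C₀ := by positivity
  refine ⟨Real.sqrt C₀, ?_⟩
  intro H hH X₃ hXl hXu V hV 𝓘 x hx α hα
  have hHpos : (0 : ℝ) < H := by exact_mod_cast hH
  have hH1 : (1 : ℝ) ≤ H := by exact_mod_cast hH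
  have hV0 : 0 < V := by linarith
  have h12pos : 0 < (H : ℝ) ^ (1 / 2 : ℝ) := by positivity
  have hm12 : (H : ℝ) ^ (-(1 / 2 : ℝ)) = ((H : ℝ) ^ (1 / 2 : ℝ))⁻¹ := Real.rpow_neg hHpos.le _
  rw [hm12] at hXl
  have hX₃pos : 0 < X₃ := lt_of_lt_of_le (inv_pos.2 h12pos) hXl
  have hXH : 1 ≤ X₃ * (H : ℝ) ^ (1 / 2 : ℝ) := by
    calc (1 : ℝ) = ((H : ℝ) ^ (1 / 2 : ℝ))⁻¹ * (H : ℝ) ^ (1 / 2 : ℝ) := by field_simp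
      _ ≤ X₃ * (H : ℝ) ^ (1 / 2 : ℝ) := mul_le_mul_of_nonneg_right hXl h12pos.le
  have h32 : (H : ℝ) ^ (3 / 2 : ℝ) = H * (H : ℝ) ^ (1 / 2 : ℝ) := by
    rw [show (3 / 2 : ℝ) = 1 + 1 / 2 by norm_num, Real.rpow_add hHpos, Real.rpow_one]
  have h32pos : 0 < (H : ℝ) ^ (3 / 2 : ℝ) := by positivity
  have h32sq : ((H : ℝ) ^ (3 / 2 : ℝ)) ^ 2 = (H : ℝ) ^ (3 : ℝ) := by
    rw [← Real.rpow_natCast, ← Real.rpow_mul hHpos.le]; norm_num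
  -- (3.8) with the factor `V`
  have h38 := Bourgain2017_eq38V hH hX₃pos hV 𝓘 x hx α hα
  set δ : ℝ := 1 / (X₃ * (H : ℝ) ^ (3 / 2 : ℝ)) with hδ
  have hδpos : 0 < δ := by positivity
  -- the range `1/H² ≤ δ ≤ 1/H`
  have hδl : 1 / (H : ℝ) ^ 2 ≤ δ := by
    rw [hδ]
    apply one_div_le_one_div_of_le (by positivity)
    calc X₃ * (H : ℝ) ^ (3 / 2 : ℝ) ≤ (H : ℝ) ^ (1 / 2 : ℝ) * (H : ℝ) ^ (3 / 2 : ℝ) :=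
          mul_le_mul_of_nonneg_right hXu h32pos.le
      _ = (H : ℝ) ^ 2 := by
          rw [← Real.rpow_add hHpos, show (1 / 2 + 3 / 2 : ℝ) = 2 by norm_num, Real.rpow_two]
  have hδu : δ ≤ 1 / H := by
    rw [hδ]
    apply one_div_le_one_div_of_le hHpos
    calc (H : ℝ) = 1 * H := (one_mul _).symm
      _ ≤ (X₃ * (H : ℝ) ^ (1 / 2 : ℝ)) * H := mul_le_mul_of_nonneg_right hXH hHpos.le
      _ = X₃ * (H : ℝ) ^ (3 / 2 : ℝ) := by rw [h32]; ring
  -- (3.10)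
  have hA := hCA H hH δ hδl hδu
  have hA' : (bourgainFirstSpacingCount H δ (H * δ) : ℝ) ≤
      max CA 0 * δ ^ 2 * (H : ℝ) ^ (10 + 2 * ε) :=
    hA.trans (mul_le_mul_of_nonneg_right
      (mul_le_mul_of_nonneg_right (le_max_left _ _) (sq_nonneg _)) (by positivity))
  -- the box factors
  have hprod := prod_bourgainBoxFactors_le hH hX₃pos hXH hV
  -- the cancellation `X₃² H⁵ · δ² H^{10+2ε} = H^{12+2ε}`
  have hcancel : X₃ ^ 2 * (H : ℝ) ^ (5 : ℝ) * (δ ^ 2 * (H : ℝ) ^ (10 + 2 * ε)) =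
      (H : ℝ) ^ (12 + 2 * ε) := by
    have e1 : X₃ ^ 2 * (H : ℝ) ^ (5 : ℝ) * (δ ^ 2 * (H : ℝ) ^ (10 + 2 * ε)) =
        (H : ℝ) ^ (5 : ℝ) * (H : ℝ) ^ (10 + 2 * ε) / ((H : ℝ) ^ (3 / 2 : ℝ)) ^ 2 := by
      rw [hδ]
      field_simp
    rw [e1, h32sq, ← Real.rpow_add hHpos, ← Real.rpow_sub hHpos]
    congr 1
    ring
  have key : (∑ I ∈ 𝓘, ‖bourgainHSum H α (x I)‖ ^ 6) ^ 2 ≤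
      C₀ * (H : ℝ) ^ (12 + 2 * ε) * (V * bourgainSecondSpacingCount 𝓘 x H V) := by
    calc (∑ I ∈ 𝓘, ‖bourgainHSum H α (x I)‖ ^ 6) ^ 2
        ≤ 624 ^ 4 * (∏ k, (1 + 2 * bourgainXBound X₃ k * (2 * bourgainYBound H V k))) *
            (bourgainSecondSpacingCount 𝓘 x H V : ℝ) *
            (bourgainFirstSpacingCount H δ (H * δ) : ℝ) := h38
      _ ≤ 624 ^ 4 * (105625 * V * X₃ ^ 2 * (H : ℝ) ^ (5 : ℝ)) *
            (bourgainSecondSpacingCount 𝓘 x H V : ℝ) *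
            (max CA 0 * δ ^ 2 * (H : ℝ) ^ (10 + 2 * ε)) := by
          gcongr
      _ = C₀ * (H : ℝ) ^ (12 + 2 * ε) * (V * bourgainSecondSpacingCount 𝓘 x H V) := by
          rw [hC₀]
          linear_combination (624 ^ 4 * 105625 * max CA 0 * V *
            (bourgainSecondSpacingCount 𝓘 x H V : ℝ)) * hcancel
  have hVB : 0 ≤ V * (bourgainSecondSpacingCount 𝓘 x H V : ℝ) := by positivity
  have hH2 : ((H : ℝ) ^ (6 + ε)) ^ 2 = (H : ℝ) ^ (12 + 2 * ε) := by
    rw [← Real.rpow_natCast, ← Real.rpow_mul hHpos.le]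
    congr 1
    push_cast
    ring
  have hrhs : C₀ * (H : ℝ) ^ (12 + 2 * ε) * (V * bourgainSecondSpacingCount 𝓘 x H V) =
      (Real.sqrt C₀ * (H : ℝ) ^ (6 + ε) *
        Real.sqrt (V * bourgainSecondSpacingCount 𝓘 x H V)) ^ 2 := by
    rw [mul_pow, mul_pow, Real.sq_sqrt hC₀0, hH2, Real.sq_sqrt hVB]
  rw [hrhs] at key
  exact (pow_le_pow_iff_left₀ (Finset.sum_nonneg fun _ _ => by positivity) (by positivity)
    two_ne_zero).1 key

end Literature.NumberTheory.LFunctions
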